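import Summits.NavierStokesRegularity.FluidComputer.PalasekTowerLineCrossing
import Summits.NavierStokesRegularity.FluidComputer.PalasekTowerHeredityWitnessCalibration

/-!
# REGISTER v2.3′: the HAND-OVER PRESSURE RATE of every registered stage (line crossing in every window)

Cell `ns-blowup`, seat `ns-blowup-fc-prover-3` (g3; prover; D-0074 GROUP C/E «BRIDGE SUPPORT»;
bears_on LADDER-NS N1, route `PalasekTowerBreakdown`, child cruxes stmt-NavierStokesRegularity-19249
`HeredityAtOne` / -19250 `HeredityFromTwo`, parent -19178 `EpisodeInductionG`, and the `first_episode`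
stub of -19179 `EpisodeBaseG` — supports only, nothing claimed or closed). Companion of
`PalasekTowerLineCrossing.lean` (the line-crossing calculus, `exists_lineCrossing_of_clayContinuation`).
LABEL: E–C typing (KERNEL analysis; every statement PROVED; no `Prop` introduced; no unproved fact).
WHAT THIS IS NOT: not Navier–Stokes evidence — nothing is constructed; no stub is proved or refuted;
NECESSARY CONDITIONS with a RATE that every registered stage satisfies by theorem.

## What is proved

* §3 `Stage.exists_window_lineCrossing` — at every hand-over `j → j+1` of every registered stage
  (`ν > 0`; any rates, schedule, margins) and every slope `Λ (τ_{j+1} − τ_j) < c₁ Y_{j+1} − c₂ Y_j`, the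
  line through `(τ_{j+1}, c₁ Y_{j+1})` is first crossed at some `t⋆ ∈ (τ_j, τ_{j+1}]`, at a global argmax,
  with `ν|Du|²_F + ⟪u, ∇p⟫ + Λ‖u‖ ≤ ⟪u, f⟫ ≤ c₄ Y_j ‖u‖`; `Stage.exists_window_pressureRate_quiet` — at a
  SILENT hand-over (`j ≥ 1`, `Λ ≥ 0`) the pressure gradient alone does it:
  `ν|Du|²_F + Λ‖u‖ ≤ −⟪u, ∇p⟫`, `‖∇p(t⋆, x⋆)‖ ≥ Λ`; the register's form on rigid quiet wide schedules;
  and THE NUMBER OF RECORD for item 19249's window `1 → 2`: the mean rate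
  `(Y₂ − (5/3) Y₁)/(τ₂ − τ₁) ∈ (2.74, 2.76)·10⁷` (`Schedule.Rigid.handoverRate_one_bounds`), so every stage
  of level `≥ 2` shows, at some instant of `(τ₁, τ₂]` and a global argmax with speed in `(4630, 6140)`,
  `ν|Du|²_F + 2.74·10⁷ ‖u‖ ≤ −⟪u, ∇p⟫`, `−⟪u, ∇p⟫ > 1.26·10¹¹` (`Stage.exists_firstSilentWindow_pressureRate`).
* §4 the first window `0 → 1` (forced era) under the GLOBAL ANCHOR: `Stage.exists_firstWindow_lineCrossing`
  (the jump is from the FLOOR `c₁ Y₀`, by `Stage.norm_τ_zero_le`), and under `Pins Λ₀ θ` THE FIRST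
  EPISODE'S PRESSURE SHARE `Stage.exists_firstWindow_pressureRate`: the force supplies at most `1/Λ₀` of
  the mean growth rate of the global speed maximum, so for every `0 ≤ μ < (1 − Λ₀⁻¹)(c₁ Y₁ − c₁ Y₀)/(τ₁ − τ₀)`
  some instant and global argmax show `ν|Du|²_F + μ‖u‖ ≤ −⟪u, ∇p⟫`; on the wide rates with `Pins 8 (6/5)`
  every `μ ≤ 6.99·10⁶` is admissible (`Stage.exists_firstWindow_pressureRate_wide`) — a necessary
  condition on every host of `first_episode` (item 19179).

References: S. Palasek, arXiv:2605.13827 §3.3, §4 [cite: Palasek2026ElementaryModel, §4]; D. Gilbarg,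
N. Trudinger, *Elliptic PDE of second order*, §3.1 [cite: GilbargTrudinger2001, §3.1].
-/

noncomputable section

namespace Summit.NavierStokesRegularity.FluidComputer.PalasekTowerClayBridge

open Set MeasureTheory Filter Topology Function Real
open scoped ENNReal ContDiff NNReal InnerProductSpace RealInnerProductSpace
open Laplacian
open Literature.Analysis.FluidPDE

/-! ## §3 Registered stages: the line crossing in every growth window -/

namespace Stage

variable {ν : ℝ} {R : TowerRates} {S : Schedule R} {m : Margins R} {k : ℕ}

/-- **LINE CROSSING AT THE HAND-OVER `j → j+1`** (`ν > 0`; any rates, schedule, margins; `j + 1 ≤ k`).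
For every slope `Λ` with `Λ (τ_{j+1} − τ_j) < c₁ Y_{j+1} − c₂ Y_j` the line through
`(τ_{j+1}, c₁ Y_{j+1})` of slope `Λ` starts above the ceiling `c₂ Y_j` at `τ_j` and ends at the floor
`c₁ Y_{j+1}` at `τ_{j+1}`, so the global speed maximum crosses it for the first time at some
`t⋆ ∈ (τ_j, τ_{j+1}]`, at a global argmax `x⋆`, with `‖u(t⋆, x⋆)‖ = c₁ Y_{j+1} − Λ (τ_{j+1} − t⋆)`,
`Λ‖u‖ ≤ ⟪u, ∂ₜu⟫` and `ν|Du|²_F + ⟪u, ∇p⟫ + Λ‖u‖ ≤ ⟪u, f⟫ ≤ c₄ Y_j ‖u‖` at `(t⋆, x⋆)` (window force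
budget `push_small`). `Λ = 0` is p441519's first hitting. [cite: Palasek2026ElementaryModel, §3.3] -/
theorem exists_window_lineCrossing (hν : 0 < ν) (s : Stage ν R S m k) {j : ℕ} (hj : j + 1 ≤ k)
    {Λ : ℝ} (hΛ : Λ * (S.τ (j + 1) - S.τ j) < S.c₁ * R.Y (j + 1) - S.c₂ * R.Y j) :
    ∃ t₀ ∈ Ioc (S.τ j) (S.τ (j + 1)), ∃ x₀ : EuclideanSpace ℝ (Fin 3),
      ‖s.u t₀ x₀‖ = S.c₁ * R.Y (j + 1) - Λ * (S.τ (j + 1) - t₀) ∧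
      (∀ x, ‖s.u t₀ x‖ ≤ ‖s.u t₀ x₀‖) ∧
      (∀ t ∈ Ico 0 t₀, ∀ x, ‖s.u t x‖ <
        S.c₁ * R.Y (j + 1) - Λ * (S.τ (j + 1) - S.τ j) + Λ * max (t - S.τ j) 0) ∧
      Λ * ‖s.u t₀ x₀‖ ≤ ⟪s.u t₀ x₀, timeDerivWithin (Icc 0 (S.τ k)) s.u t₀ x₀⟫ ∧
      ν * frobeniusNormSq (fderiv ℝ (s.u t₀) x₀) + ⟪s.u t₀ x₀, gradient (s.p t₀) x₀⟫ +
          Λ * ‖s.u t₀ x₀‖ ≤ ⟪s.u t₀ x₀, S.f t₀ x₀⟫ ∧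
      ν * frobeniusNormSq (fderiv ℝ (s.u t₀) x₀) + ⟪s.u t₀ x₀, gradient (s.p t₀) x₀⟫ +
          Λ * ‖s.u t₀ x₀‖ ≤ S.c₄ * R.Y j * ‖s.u t₀ x₀‖ := by
  have hYj : 0 < R.Y j := Real.rpow_pos_of_pos (R.N_pos j) _
  have hYj1 : 0 < R.Y (j + 1) := Real.rpow_pos_of_pos (R.N_pos (j + 1)) _
  have hc₂ : 0 < S.c₂ := s.c₂_pos
  have hc₁ : 0 < S.c₁ := S.c₁_pos
  set L₁ : ℝ := S.c₁ * R.Y (j + 1) - Λ * (S.τ (j + 1) - S.τ j) with hL₁def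
  have hL₁A : S.c₂ * R.Y j < L₁ := by simp only [hL₁def]; linarith
  have hL₁ : 0 < L₁ := lt_trans (mul_pos hc₂ hYj) hL₁A
  have hL₂ : 0 < L₁ + Λ * (S.τ (j + 1) - S.τ j) := by
    have : L₁ + Λ * (S.τ (j + 1) - S.τ j) = S.c₁ * R.Y (j + 1) := by simp only [hL₁def]; ring
    rw [this]; exact mul_pos hc₁ hYj1
  have hτj : 0 ≤ S.τ j := (S.τ_pos j).le
  have hbefore : ∀ t ∈ Icc 0 (S.τ j), ∀ x, ‖s.u t x‖ < L₁ := fun t ht x =>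
    lt_of_le_of_lt (s.ceiling j ((Nat.le_succ j).trans hj) t ht x) hL₁A
  have hreach : ∃ x, L₁ + Λ * (S.τ (j + 1) - S.τ j) ≤ ‖s.u (S.τ (j + 1)) x‖ := by
    obtain ⟨x, -, hx⟩ := s.floor (j + 1) hj
    exact ⟨x, by simp only [hL₁def]; linarith⟩
  obtain ⟨t₀, ht₀, x₀, hval, hmax, hstrict, htime, hineq⟩ :=
    exists_lineCrossing_of_clayContinuation hν (S.τ_pos k) s.classical s.hasRapidSpatialDecay_zero
      S.force_smooth S.force_decay s.energy hτj (S.τ_lt_succ j).le (S.τ_mono hj) hL₁ hL₂ hbefore hreach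
  have hval' : ‖s.u t₀ x₀‖ = S.c₁ * R.Y (j + 1) - Λ * (S.τ (j + 1) - t₀) := by
    rw [hval]; simp only [hL₁def]; ring
  have hwin : t₀ ∈ Icc (S.τ j) (S.τ (j + 1)) := ⟨ht₀.1.le, ht₀.2⟩
  have hf := s.inner_force_le_of_window hwin x₀
  refine ⟨t₀, ht₀, x₀, hval', hmax, hstrict, htime, hineq, hineq.trans ?_⟩
  calc ⟪s.u t₀ x₀, S.f t₀ x₀⟫ ≤ ‖s.u t₀ x₀‖ * (S.c₄ * R.Y j) := hf
    _ = S.c₄ * R.Y j * ‖s.u t₀ x₀‖ := by ring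

/-- **THE HAND-OVER PRESSURE RATE at a SILENT hand-over** (`ν > 0`, quiet schedule, `1 ≤ j`,
`j + 1 ≤ k`, slope `0 ≤ Λ`, `Λ (τ_{j+1} − τ_j) < c₁ Y_{j+1} − c₂ Y_j`): at the first crossing of the line
the force is zero, the speed lies in the band `(c₂ Y_j, c₁ Y_{j+1}]`, is globally maximal and exceeds
every earlier speed, and the pressure gradient ALONE accelerates the fluid at rate at least `Λ` against
its own viscous rate: `ν|Du|²_F + Λ‖u‖ ≤ −⟪u, ∇p⟫`, in particular `‖∇p(t⋆, x⋆)‖ ≥ Λ`. Every registered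
stage passes this test at EVERY admissible slope; nothing here says such a stage exists.
[cite: Palasek2026ElementaryModel, §4] -/
theorem exists_window_pressureRate_quiet (hν : 0 < ν) (s : Stage ν R S m k) (hQ : S.Quiet)
    {j : ℕ} (hj1 : 1 ≤ j) (hj : j + 1 ≤ k) {Λ : ℝ} (hΛ0 : 0 ≤ Λ)
    (hΛ : Λ * (S.τ (j + 1) - S.τ j) < S.c₁ * R.Y (j + 1) - S.c₂ * R.Y j) :
    ∃ t₀ ∈ Ioc (S.τ j) (S.τ (j + 1)), ∃ x₀ : EuclideanSpace ℝ (Fin 3),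
      ‖s.u t₀ x₀‖ = S.c₁ * R.Y (j + 1) - Λ * (S.τ (j + 1) - t₀) ∧
      S.c₂ * R.Y j < ‖s.u t₀ x₀‖ ∧ ‖s.u t₀ x₀‖ ≤ S.c₁ * R.Y (j + 1) ∧
      (∀ x, ‖s.u t₀ x‖ ≤ ‖s.u t₀ x₀‖) ∧
      (∀ t ∈ Ico 0 t₀, ∀ x, ‖s.u t x‖ < ‖s.u t₀ x₀‖) ∧
      Λ * ‖s.u t₀ x₀‖ ≤ ⟪s.u t₀ x₀, timeDerivWithin (Icc 0 (S.τ k)) s.u t₀ x₀⟫ ∧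
      ν * frobeniusNormSq (fderiv ℝ (s.u t₀) x₀) + Λ * ‖s.u t₀ x₀‖ ≤
        - ⟪s.u t₀ x₀, gradient (s.p t₀) x₀⟫ ∧
      Λ ≤ ‖gradient (s.p t₀) x₀‖ := by
  obtain ⟨t₀, ht₀, x₀, hval, hmax, hstrict, htime, hineq, -⟩ := s.exists_window_lineCrossing hν hj hΛ
  have h1 : S.τ 1 ≤ t₀ := (S.τ_mono hj1).trans ht₀.1.le
  rw [hQ.apply h1 x₀, inner_zero_right] at hineq
  have hYj : 0 < R.Y j := Real.rpow_pos_of_pos (R.N_pos j) _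
  have hc₂ : 0 < S.c₂ := s.c₂_pos
  have hlow : S.c₂ * R.Y j < ‖s.u t₀ x₀‖ := by
    rw [hval]
    have : Λ * (S.τ (j + 1) - t₀) ≤ Λ * (S.τ (j + 1) - S.τ j) :=
      mul_le_mul_of_nonneg_left (by linarith [ht₀.1]) hΛ0
    linarith
  have hupp : ‖s.u t₀ x₀‖ ≤ S.c₁ * R.Y (j + 1) := by
    rw [hval]
    have : 0 ≤ Λ * (S.τ (j + 1) - t₀) := mul_nonneg hΛ0 (by linarith [ht₀.2])
    linarith
  have hpos : 0 < ‖s.u t₀ x₀‖ := lt_trans (mul_pos hc₂ hYj) hlow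
  have hstrict' : ∀ t ∈ Ico 0 t₀, ∀ x, ‖s.u t x‖ < ‖s.u t₀ x₀‖ := by
    intro t ht x
    refine lt_of_lt_of_le (hstrict t ht x) ?_
    rw [hval]
    have hm : Λ * max (t - S.τ j) 0 ≤ Λ * (t₀ - S.τ j) :=
      mul_le_mul_of_nonneg_left (max_le (by linarith [ht.2]) (by linarith [ht₀.1])) hΛ0
    linarith
  have hP : ν * frobeniusNormSq (fderiv ℝ (s.u t₀) x₀) + Λ * ‖s.u t₀ x₀‖ ≤
      - ⟪s.u t₀ x₀, gradient (s.p t₀) x₀⟫ := by linarith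
  refine ⟨t₀, ht₀, x₀, hval, hlow, hupp, hmax, hstrict', htime, hP, ?_⟩
  have hF : 0 ≤ ν * frobeniusNormSq (fderiv ℝ (s.u t₀) x₀) :=
    mul_nonneg hν.le (frobeniusNormSq_nonneg _)
  have hCS : - ⟪s.u t₀ x₀, gradient (s.p t₀) x₀⟫ ≤ ‖s.u t₀ x₀‖ * ‖gradient (s.p t₀) x₀‖ := by
    have := abs_real_inner_le_norm (s.u t₀ x₀) (gradient (s.p t₀) x₀)
    have := neg_abs_le ⟪s.u t₀ x₀, gradient (s.p t₀) x₀⟫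
    linarith
  have h2 : Λ * ‖s.u t₀ x₀‖ ≤ ‖gradient (s.p t₀) x₀‖ * ‖s.u t₀ x₀‖ := by linarith
  exact le_of_mul_le_mul_right h2 hpos

/-- **THE REGISTER'S FORM.** For a stage of a RIGID, QUIET schedule on the wide-base rates (`ν > 0`;
any margins — in particular the `routeG` stages at `ν = 1` over pinned rigid quiet schedules that the
cruxes `HeredityAtOne` / `HeredityFromTwo` / `EpisodeInductionG` quantify over): at every hand-over
`j → j+1` with `1 ≤ j`, `j + 1 ≤ k`, for EVERY slope `0 ≤ Λ` with
`Λ · (253/25) log N_{j+1} / A_j < Y_{j+1} − (5/3) Y_j`, some instant `t⋆ ∈ (τ_j, τ_{j+1}]` and global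
argmax `x⋆` with speed in `((5/3) Y_j, Y_{j+1}]` satisfy `ν|Du|²_F + Λ‖u‖ ≤ −⟪u, ∇p⟫`, `‖∇p‖ ≥ Λ`.
[cite: Palasek2026ElementaryModel, §4] -/
theorem exists_window_pressureRate_rigid_quiet {S : Schedule TowerRates.wide}
    {m : Margins TowerRates.wide} {k : ℕ} (hν : 0 < ν) (s : Stage ν TowerRates.wide S m k)
    (hR : S.Rigid) (hQ : S.Quiet) {j : ℕ} (hj1 : 1 ≤ j) (hj : j + 1 ≤ k) {Λ : ℝ} (hΛ0 : 0 ≤ Λ)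
    (hΛ : Λ * (S.c₅ * Real.log (TowerRates.wide.N (j + 1)) / TowerRates.wide.A j) <
      TowerRates.wide.Y (j + 1) - 5 / 3 * TowerRates.wide.Y j) :
    ∃ t₀ ∈ Ioc (S.τ j) (S.τ (j + 1)), ∃ x₀ : EuclideanSpace ℝ (Fin 3),
      5 / 3 * TowerRates.wide.Y j < ‖s.u t₀ x₀‖ ∧ ‖s.u t₀ x₀‖ ≤ TowerRates.wide.Y (j + 1) ∧
      (∀ x, ‖s.u t₀ x‖ ≤ ‖s.u t₀ x₀‖) ∧
      (∀ t ∈ Ico 0 t₀, ∀ x, ‖s.u t x‖ < ‖s.u t₀ x₀‖) ∧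
      ν * frobeniusNormSq (fderiv ℝ (s.u t₀) x₀) + Λ * ‖s.u t₀ x₀‖ ≤
        - ⟪s.u t₀ x₀, gradient (s.p t₀) x₀⟫ ∧
      Λ ≤ ‖gradient (s.p t₀) x₀‖ := by
  have hw : S.τ (j + 1) - S.τ j = S.c₅ * Real.log (TowerRates.wide.N (j + 1)) / TowerRates.wide.A j := by
    have := hR.window_eq j; linarith
  have hΛ' : Λ * (S.τ (j + 1) - S.τ j) <
      S.c₁ * TowerRates.wide.Y (j + 1) - S.c₂ * TowerRates.wide.Y j := by
    rw [hw, hR.c₁_eq, hR.c₂_eq, one_mul]; exact hΛ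
  obtain ⟨t₀, ht₀, x₀, -, hlow, hupp, hmax, hstrict, -, hP, hgrad⟩ :=
    s.exists_window_pressureRate_quiet hν hQ hj1 hj hΛ0 hΛ'
  rw [hR.c₂_eq] at hlow
  rw [hR.c₁_eq, one_mul] at hupp
  exact ⟨t₀, ht₀, x₀, hlow, hupp, hmax, hstrict, hP, hgrad⟩

end Stage

/-- **THE NUMBER OF RECORD for item 19249's hand-over `1 → 2`.** On every rigid schedule on the wide
rates the mean growth rate the global speed maximum must achieve across the first silent window,
`(c₁ Y₂ − c₂ Y₁)/(τ₂ − τ₁) = (Y₂ − (5/3) Y₁) · A₁ / ((253/25) log N₂)`, lies in `(2.74·10⁷, 2.76·10⁷)`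
(`Y₁ ∈ (2778, 2779)`, `Y₂ ∈ (6139, 6140)`, `τ₂ − τ₁ ∈ (5.483, 5.484)·10⁻⁵`): every slope `Λ ≤ 2.74·10⁷`
is admissible in `Stage.exists_window_pressureRate_quiet` at `j = 1`. [folklore] -/
theorem Schedule.Rigid.handoverRate_one_bounds {S : Schedule TowerRates.wide} (h : S.Rigid) :
    (27400000 : ℝ) < (S.c₁ * TowerRates.wide.Y 2 - S.c₂ * TowerRates.wide.Y 1) / (S.τ 2 - S.τ 1) ∧
      (S.c₁ * TowerRates.wide.Y 2 - S.c₂ * TowerRates.wide.Y 1) / (S.τ 2 - S.τ 1) < 27600000 := by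
  obtain ⟨hw1, hw2⟩ := h.window_one_bounds
  obtain ⟨hY1, hY1'⟩ := TowerRates.wide_Y_one_bounds
  obtain ⟨hY2, hY2'⟩ := TowerRates.wide_Y_two_bounds
  have hw : 0 < S.τ 2 - S.τ 1 := by linarith
  rw [h.c₁_eq, h.c₂_eq, one_mul]
  constructor
  · rw [lt_div_iff₀ hw]; nlinarith
  · rw [div_lt_iff₀ hw]; nlinarith

/-- **Corollary of record (`j = 1`, slope `2.74·10⁷`).** Every stage at level `k ≥ 2` of a rigid quiet
schedule on the wide rates (`ν > 0`, any margins) has an instant `t⋆ ∈ (τ₁, τ₂]` and a global argmax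
`x⋆` with speed in `((5/3) Y₁, Y₂] ⊂ (4630, 6140]` where
`ν|Du|²_F + 2.74·10⁷ · ‖u‖ ≤ −⟪u, ∇p⟫` — so `‖∇p(t⋆, x⋆)‖ ≥ 2.74·10⁷` and
`−⟪u, ∇p⟫(t⋆, x⋆) > 1.26·10¹¹`. [cite: Palasek2026ElementaryModel, §4] -/
theorem Stage.exists_firstSilentWindow_pressureRate {S : Schedule TowerRates.wide}
    {m : Margins TowerRates.wide} {k : ℕ} {ν : ℝ} (hν : 0 < ν)
    (s : Stage ν TowerRates.wide S m k) (hR : S.Rigid) (hQ : S.Quiet) (hk : 2 ≤ k) :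
    ∃ t₀ ∈ Ioc (S.τ 1) (S.τ 2), ∃ x₀ : EuclideanSpace ℝ (Fin 3),
      4630 < ‖s.u t₀ x₀‖ ∧ ‖s.u t₀ x₀‖ < 6140 ∧
      (∀ x, ‖s.u t₀ x‖ ≤ ‖s.u t₀ x₀‖) ∧
      (∀ t ∈ Ico 0 t₀, ∀ x, ‖s.u t x‖ < ‖s.u t₀ x₀‖) ∧
      ν * frobeniusNormSq (fderiv ℝ (s.u t₀) x₀) + 27400000 * ‖s.u t₀ x₀‖ ≤
        - ⟪s.u t₀ x₀, gradient (s.p t₀) x₀⟫ ∧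
      27400000 ≤ ‖gradient (s.p t₀) x₀‖ ∧
      126000000000 < - ⟪s.u t₀ x₀, gradient (s.p t₀) x₀⟫ := by
  obtain ⟨hrate, -⟩ := hR.handoverRate_one_bounds
  have hw : 0 < S.τ 2 - S.τ 1 := by linarith [S.τ_lt_succ 1]
  have hΛ : (27400000 : ℝ) * (S.τ (1 + 1) - S.τ 1) <
      S.c₁ * TowerRates.wide.Y (1 + 1) - S.c₂ * TowerRates.wide.Y 1 := by
    rw [show (1 : ℕ) + 1 = 2 from rfl]
    exact (lt_div_iff₀ hw).1 hrate
  obtain ⟨t₀, ht₀, x₀, -, hlow, hupp, hmax, hstrict, -, hP, hgrad⟩ :=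
    s.exists_window_pressureRate_quiet hν hQ le_rfl hk (by norm_num) hΛ
  rw [show (1 : ℕ) + 1 = 2 from rfl] at ht₀ hupp
  obtain ⟨hc1, -⟩ := hR.ceiling_one_bounds
  obtain ⟨-, hY2'⟩ := TowerRates.wide_Y_two_bounds
  have hlow' : 4630 < ‖s.u t₀ x₀‖ := lt_trans hc1 hlow
  have hupp' : ‖s.u t₀ x₀‖ < 6140 := by
    rw [hR.c₁_eq, one_mul] at hupp; exact lt_of_le_of_lt hupp hY2'
  refine ⟨t₀, ht₀, x₀, hlow', hupp', hmax, hstrict, hP, hgrad, ?_⟩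
  have hF : 0 ≤ ν * frobeniusNormSq (fderiv ℝ (s.u t₀) x₀) :=
    mul_nonneg hν.le (frobeniusNormSq_nonneg _)
  nlinarith

/-! ## §4 The first window `0 → 1`: the force supplies at most `1/Λ₀` of the rate -/

namespace Stage

variable {ν : ℝ} {R : TowerRates} {S : Schedule R} {k : ℕ}

/-- **LINE CROSSING IN THE FIRST WINDOW under the GLOBAL ANCHOR** (`ν > 0`, `1 ≤ k`, any rates and
schedule): the anchor gives `‖u‖ ≤ c₁ Y₀` EVERYWHERE on `[0, τ₀]` (`Stage.norm_τ_zero_le`), so for every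
slope `Λ` with `Λ (τ₁ − τ₀) < c₁ Y₁ − c₁ Y₀` (the jump is from the FLOOR `c₁ Y₀`, not from the ceiling)
the line through `(τ₁, c₁ Y₁)` is first crossed at some `t⋆ ∈ (τ₀, τ₁]`, at a global argmax, where
`ν|Du|²_F + ⟪u, ∇p⟫ + Λ‖u‖ ≤ ⟪u, f⟫ ≤ c₄ Y₀ ‖u‖`, i.e. `ν|Du|²_F + (Λ − c₄ Y₀)‖u‖ ≤ −⟪u, ∇p⟫`.
[cite: Palasek2026ElementaryModel, §3.3] -/
theorem exists_firstWindow_lineCrossing (hν : 0 < ν) (s : Stage ν R S (Margins.routeG R) k)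
    (hk : 1 ≤ k) {Λ : ℝ} (hΛ : Λ * (S.τ 1 - S.τ 0) < S.c₁ * R.Y 1 - S.c₁ * R.Y 0) :
    ∃ t₀ ∈ Ioc (S.τ 0) (S.τ 1), ∃ x₀ : EuclideanSpace ℝ (Fin 3),
      ‖s.u t₀ x₀‖ = S.c₁ * R.Y 1 - Λ * (S.τ 1 - t₀) ∧
      (∀ x, ‖s.u t₀ x‖ ≤ ‖s.u t₀ x₀‖) ∧
      (∀ t ∈ Ico 0 t₀, ∀ x, ‖s.u t x‖ <
        S.c₁ * R.Y 1 - Λ * (S.τ 1 - S.τ 0) + Λ * max (t - S.τ 0) 0) ∧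
      Λ * ‖s.u t₀ x₀‖ ≤ ⟪s.u t₀ x₀, timeDerivWithin (Icc 0 (S.τ k)) s.u t₀ x₀⟫ ∧
      ν * frobeniusNormSq (fderiv ℝ (s.u t₀) x₀) + ⟪s.u t₀ x₀, gradient (s.p t₀) x₀⟫ +
          Λ * ‖s.u t₀ x₀‖ ≤ ⟪s.u t₀ x₀, S.f t₀ x₀⟫ ∧
      ν * frobeniusNormSq (fderiv ℝ (s.u t₀) x₀) + (Λ - S.c₄ * R.Y 0) * ‖s.u t₀ x₀‖ ≤
        - ⟪s.u t₀ x₀, gradient (s.p t₀) x₀⟫ := by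
  have hY0 : 0 < R.Y 0 := Real.rpow_pos_of_pos (R.N_pos 0) _
  have hY1 : 0 < R.Y 1 := Real.rpow_pos_of_pos (R.N_pos 1) _
  have hc₁ : 0 < S.c₁ := S.c₁_pos
  set L₁ : ℝ := S.c₁ * R.Y 1 - Λ * (S.τ 1 - S.τ 0) with hL₁def
  have hL₁A : S.c₁ * R.Y 0 < L₁ := by simp only [hL₁def]; linarith
  have hL₁ : 0 < L₁ := lt_trans (mul_pos hc₁ hY0) hL₁A
  have hL₂ : 0 < L₁ + Λ * (S.τ 1 - S.τ 0) := by
    have : L₁ + Λ * (S.τ 1 - S.τ 0) = S.c₁ * R.Y 1 := by simp only [hL₁def]; ring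
    rw [this]; exact mul_pos hc₁ hY1
  have hτ0 : 0 ≤ S.τ 0 := (S.τ_pos 0).le
  have hbefore : ∀ t ∈ Icc 0 (S.τ 0), ∀ x, ‖s.u t x‖ < L₁ := by
    intro t ht x
    refine lt_of_le_of_lt ?_ hL₁A
    rcases ht.2.eq_or_lt with h' | h'
    · rw [h']; exact s.norm_τ_zero_le x
    · exact (s.routeG_anchorGlobal t ⟨ht.1, h'⟩ x).le
  have hreach : ∃ x, L₁ + Λ * (S.τ 1 - S.τ 0) ≤ ‖s.u (S.τ 1) x‖ := by
    obtain ⟨x, -, hx⟩ := s.floor 1 hk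
    exact ⟨x, by simp only [hL₁def]; linarith⟩
  obtain ⟨t₀, ht₀, x₀, hval, hmax, hstrict, htime, hineq⟩ :=
    exists_lineCrossing_of_clayContinuation hν (S.τ_pos k) s.classical s.hasRapidSpatialDecay_zero
      S.force_smooth S.force_decay s.energy hτ0 (S.τ_lt_succ 0).le (S.τ_mono hk) hL₁ hL₂ hbefore hreach
  have hval' : ‖s.u t₀ x₀‖ = S.c₁ * R.Y 1 - Λ * (S.τ 1 - t₀) := by
    rw [hval]; simp only [hL₁def]; ring
  have hwin : t₀ ∈ Icc (S.τ 0) (S.τ (0 + 1)) := ⟨ht₀.1.le, ht₀.2⟩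
  have hf := s.inner_force_le_of_window hwin x₀
  refine ⟨t₀, ht₀, x₀, hval', hmax, hstrict, htime, hineq, ?_⟩
  have : ⟪s.u t₀ x₀, S.f t₀ x₀⟫ ≤ S.c₄ * R.Y 0 * ‖s.u t₀ x₀‖ := by
    calc ⟪s.u t₀ x₀, S.f t₀ x₀⟫ ≤ ‖s.u t₀ x₀‖ * (S.c₄ * R.Y 0) := hf
      _ = S.c₄ * R.Y 0 * ‖s.u t₀ x₀‖ := by ring
  nlinarith

/-- **THE FIRST EPISODE'S PRESSURE SHARE** (`ν > 0`, `1 ≤ k`, pins `Pins Λ₀ θ` with `Λ₀ > 0`, global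
anchor). The window force impulse is at most `1/Λ₀` of the jump `c₁ Y₁ − c₂ Y₀ ≤ c₁ Y₁ − c₁ Y₀`
(`Pins.impulse`), so the force's contribution `c₄ Y₀` to the growth rate of the global speed maximum
is at most `(c₁ Y₁ − c₁ Y₀)/(Λ₀ (τ₁ − τ₀))`: for every rate `0 ≤ μ` with
`μ (τ₁ − τ₀) < (1 − Λ₀⁻¹)(c₁ Y₁ − c₁ Y₀)` there are `t⋆ ∈ (τ₀, τ₁]` and a global argmax `x⋆` with speed
in `(c₁ Y₀, c₁ Y₁]`, exceeding all earlier speeds, where THE PRESSURE GRADIENT accelerates the fluid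
at rate at least `μ` against its own viscous rate: `ν|Du|²_F + μ‖u‖ ≤ −⟪u, ∇p⟫`. A necessary condition
on every host of the stub `first_episode` of item 19179 (with `Λ₀ = 8`: the pressure must supply `7/8`
of the mean rate). [cite: Palasek2026ElementaryModel, §3.3] -/
theorem exists_firstWindow_pressureRate (hν : 0 < ν) {Λ₀ θ : ℝ} (hP : S.Pins Λ₀ θ) (hΛ₀ : 0 < Λ₀)
    (s : Stage ν R S (Margins.routeG R) k) (hk : 1 ≤ k) {μ : ℝ} (hμ0 : 0 ≤ μ)
    (hμ : μ * (S.τ 1 - S.τ 0) < (1 - Λ₀⁻¹) * (S.c₁ * R.Y 1 - S.c₁ * R.Y 0)) :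
    ∃ t₀ ∈ Ioc (S.τ 0) (S.τ 1), ∃ x₀ : EuclideanSpace ℝ (Fin 3),
      S.c₁ * R.Y 0 < ‖s.u t₀ x₀‖ ∧ ‖s.u t₀ x₀‖ ≤ S.c₁ * R.Y 1 ∧
      (∀ x, ‖s.u t₀ x‖ ≤ ‖s.u t₀ x₀‖) ∧
      (∀ t ∈ Ico 0 t₀, ∀ x, ‖s.u t x‖ < ‖s.u t₀ x₀‖) ∧
      (μ + S.c₄ * R.Y 0) * ‖s.u t₀ x₀‖ ≤ ⟪s.u t₀ x₀, timeDerivWithin (Icc 0 (S.τ k)) s.u t₀ x₀⟫ ∧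
      ν * frobeniusNormSq (fderiv ℝ (s.u t₀) x₀) + μ * ‖s.u t₀ x₀‖ ≤
        - ⟪s.u t₀ x₀, gradient (s.p t₀) x₀⟫ := by
  have hY0 : 0 < R.Y 0 := Real.rpow_pos_of_pos (R.N_pos 0) _
  have hc₁ : 0 < S.c₁ := S.c₁_pos
  have hc₄ : 0 ≤ S.c₄ := S.c₄_nonneg
  have hw : 0 < S.τ 1 - S.τ 0 := by linarith [S.τ_lt_succ 0]
  -- the force budget: `Λ₀ c₄ Y₀ (τ₁ − τ₀) ≤ c₁ Y₁ − c₂ Y₀ ≤ c₁ Y₁ − c₁ Y₀`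
  have himp := hP.impulse 0
  rw [zero_add] at himp
  have hc₁₂ : S.c₁ * R.Y 0 ≤ S.c₂ * R.Y 0 := mul_le_mul_of_nonneg_right s.c₁_le_c₂ hY0.le
  have hbudget : S.c₄ * R.Y 0 * (S.τ 1 - S.τ 0) ≤ Λ₀⁻¹ * (S.c₁ * R.Y 1 - S.c₁ * R.Y 0) := by
    rw [le_inv_mul_iff₀' hΛ₀]
    have e : Λ₀ * (S.c₄ * R.Y 0) * (S.τ 1 - S.τ 0) = (S.c₄ * R.Y 0 * (S.τ 1 - S.τ 0)) * Λ₀ := by ring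
    linarith
  set Λ : ℝ := μ + S.c₄ * R.Y 0 with hΛdef
  have hΛ0 : 0 ≤ Λ := add_nonneg hμ0 (mul_nonneg hc₄ hY0.le)
  have hΛ : Λ * (S.τ 1 - S.τ 0) < S.c₁ * R.Y 1 - S.c₁ * R.Y 0 := by
    have e : Λ * (S.τ 1 - S.τ 0) = μ * (S.τ 1 - S.τ 0) + S.c₄ * R.Y 0 * (S.τ 1 - S.τ 0) := by
      simp only [hΛdef]; ring
    have e2 : (1 - Λ₀⁻¹) * (S.c₁ * R.Y 1 - S.c₁ * R.Y 0) + Λ₀⁻¹ * (S.c₁ * R.Y 1 - S.c₁ * R.Y 0) =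
        S.c₁ * R.Y 1 - S.c₁ * R.Y 0 := by ring
    linarith
  obtain ⟨t₀, ht₀, x₀, hval, hmax, hstrict, htime, -, hPr⟩ := s.exists_firstWindow_lineCrossing hν hk hΛ
  have hlow : S.c₁ * R.Y 0 < ‖s.u t₀ x₀‖ := by
    rw [hval]
    have : Λ * (S.τ 1 - t₀) ≤ Λ * (S.τ 1 - S.τ 0) :=
      mul_le_mul_of_nonneg_left (by linarith [ht₀.1]) hΛ0
    linarith
  have hupp : ‖s.u t₀ x₀‖ ≤ S.c₁ * R.Y 1 := by
    rw [hval]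
    have : 0 ≤ Λ * (S.τ 1 - t₀) := mul_nonneg hΛ0 (by linarith [ht₀.2])
    linarith
  have hstrict' : ∀ t ∈ Ico 0 t₀, ∀ x, ‖s.u t x‖ < ‖s.u t₀ x₀‖ := by
    intro t ht x
    refine lt_of_lt_of_le (hstrict t ht x) ?_
    rw [hval]
    have hm : Λ * max (t - S.τ 0) 0 ≤ Λ * (t₀ - S.τ 0) :=
      mul_le_mul_of_nonneg_left (max_le (by linarith [ht.2]) (by linarith [ht₀.1])) hΛ0
    linarith
  refine ⟨t₀, ht₀, x₀, hlow, hupp, hmax, hstrict', htime, ?_⟩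
  have e : (Λ - S.c₄ * R.Y 0) = μ := by simp only [hΛdef]; ring
  rw [e] at hPr
  exact hPr

/-- **THE REGISTER'S FORM of the first episode's pressure share** (wide rates, `Pins 8 (6/5)`, rigid,
`ν > 0`, `1 ≤ k`): `c₁ = 1`, `Λ₀ = 8`, `τ₁ − τ₀ = (253/25) log N₁ / A₀ ∈ (1.7845, 1.7846)·10⁻⁴`,
`Y₀ ∈ (1351, 1352)`, `Y₁ ∈ (2778, 2779)`, so `(7/8)(Y₁ − Y₀)/(τ₁ − τ₀) > 6.99·10⁶`: for EVERY rate
`0 ≤ μ ≤ 6.99·10⁶` some instant of the first window and global argmax with speed in `(Y₀, Y₁]` show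
`ν|Du|²_F + μ‖u‖ ≤ −⟪u, ∇p⟫` — at `μ = 6.99·10⁶`: `−⟪u, ∇p⟫ ≥ 6.99·10⁶ · 1351 > 9.44·10⁹` there.
[cite: Palasek2026ElementaryModel, §3.3] -/
theorem exists_firstWindow_pressureRate_wide {S : Schedule TowerRates.wide} {k : ℕ} (hν : 0 < ν)
    (hP : S.Pins 8 (6 / 5)) (hR : S.Rigid)
    (s : Stage ν TowerRates.wide S (Margins.routeG TowerRates.wide) k) (hk : 1 ≤ k)
    {μ : ℝ} (hμ0 : 0 ≤ μ) (hμ : μ ≤ 6990000) :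
    ∃ t₀ ∈ Ioc (S.τ 0) (S.τ 1), ∃ x₀ : EuclideanSpace ℝ (Fin 3),
      1351 < ‖s.u t₀ x₀‖ ∧ ‖s.u t₀ x₀‖ < 2779 ∧
      (∀ x, ‖s.u t₀ x‖ ≤ ‖s.u t₀ x₀‖) ∧
      (∀ t ∈ Ico 0 t₀, ∀ x, ‖s.u t x‖ < ‖s.u t₀ x₀‖) ∧
      ν * frobeniusNormSq (fderiv ℝ (s.u t₀) x₀) + μ * ‖s.u t₀ x₀‖ ≤
        - ⟪s.u t₀ x₀, gradient (s.p t₀) x₀⟫ ∧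
      μ * 1351 ≤ - ⟪s.u t₀ x₀, gradient (s.p t₀) x₀⟫ := by
  obtain ⟨hw1, hw2⟩ := hR.window_zero_bounds
  obtain ⟨hY0, hY0'⟩ := TowerRates.wide_Y_zero_bounds
  obtain ⟨hY1, hY1'⟩ := TowerRates.wide_Y_one_bounds
  have hμ' : μ * (S.τ 1 - S.τ 0) <
      (1 - (8 : ℝ)⁻¹) * (S.c₁ * TowerRates.wide.Y 1 - S.c₁ * TowerRates.wide.Y 0) := by
    rw [hR.c₁_eq, one_mul, one_mul]
    have hw0 : 0 < S.τ 1 - S.τ 0 := by linarith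
    nlinarith
  obtain ⟨t₀, ht₀, x₀, hlow, hupp, hmax, hstrict, -, hPr⟩ :=
    s.exists_firstWindow_pressureRate hν hP (by norm_num) hk hμ0 hμ'
  rw [hR.c₁_eq, one_mul] at hlow hupp
  have hlow' : 1351 < ‖s.u t₀ x₀‖ := lt_trans hY0 hlow
  have hupp' : ‖s.u t₀ x₀‖ < 2779 := lt_of_le_of_lt hupp hY1'
  refine ⟨t₀, ht₀, x₀, hlow', hupp', hmax, hstrict, hPr, ?_⟩
  have hF : 0 ≤ ν * frobeniusNormSq (fderiv ℝ (s.u t₀) x₀) :=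
    mul_nonneg hν.le (frobeniusNormSq_nonneg _)
  have h1 : μ * 1351 ≤ μ * ‖s.u t₀ x₀‖ := mul_le_mul_of_nonneg_left hlow'.le hμ0
  linarith

end Stage

end Summit.NavierStokesRegularity.FluidComputer.PalasekTowerClayBridge

end
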